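import Mathlib.Algebra.Order.BigOperators.Ring.Finset
import Mathlib.Algebra.BigOperators.Intervals
import Mathlib.Analysis.SpecialFunctions.Pow.Real
import HarnessLib

/-!
# Log-convex sequences on a finite range: the chord bound

A real sequence `g` is log-convex on the range `[0, M]` when `g (i+1)² ≤ g i · g (i+2)` for `i + 2 ≤ M` — the form in
which the Schwarz inequality delivers diagonal correlators `n ↦ ⟨θĀ · τₙ A⟩` of a reflection-positive lattice functional,
and, on a FINITE torus, only on a finite range of separations.  On the whole of `ℕ` an eventual exponential bound
`g n ≤ K rⁿ` with any constant forces the one-step ratio bound `g (n+1) ≤ r · g n` (ratios are non-decreasing and the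
range is infinite: `Literature.MathematicalPhysics.QuantumFieldTheory.TransferDecayUpgrade`); on a finite range this
argument is unavailable and only the CHORD survives:

* `eq_zero_of_logConvexOn_of_eq_zero` — a zero anywhere in the range kills the whole interior;
* `pow_le_pow_mul_pow_of_logConvexOn` — **the chord bound** `g j ^ M ≤ g 0 ^ (M − j) · g M ^ j` (`j ≤ M`), i.e.
  `log g` lies below its chord; `pow_le_pow_mul_pow_of_logConvexOn'` on a translated range `[n₀, N]`;
* `le_mul_pow_of_logConvexOn` — **when an endpoint constant is harmless**: from `g 0 ≤ A` and `g M ≤ W · r ^ M` one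
  gets, at any rate `r' > 0`, `g j ≤ max A 1 · max (W (r/r')^M) 1 · r'^j` for all `j ≤ M`; the endpoint constant `W`
  enters only through `W (r/r')^M`, which is `≤ 1` as soon as `log W ≤ M log (r'/r)` (lattice reading: on a torus of
  `M` time steps a per-observable clustering constant `W` at rate `e^{−εa}` costs nothing at any slower rate `e^{−ε'a}`
  once `log W ≤ (ε − ε') a M`; without such a relation the constant survives diluted as `W^{j/M}`, and the log-linear
  interpolant shows this is sharp).

Elementary (monotone ratios / geometric means); Mathlib has `ConvexOn` for functions of a real variable but no discrete
log-convexity on ranges, and the tree's whole-`ℕ` lemmas (`StaticPotential.dichotomy_of_logConvex`,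
`sub_succ_le_of_logConvex`) assume positivity or the full range. [folklore]
-/

namespace Literature.Analysis.Convex

section Chord

open Finset

/-- Zeros of a log-convex real sequence on a finite range (`g (i+1)² ≤ g i · g (i+2)` for `i + 2 ≤ M`) propagate
to the whole INTERIOR of the range: if `g i₀ = 0` for some `i₀ ≤ M` then `g j = 0` for all `0 < j < M` (the
endpoints may stay non-zero: `(1, 0, …, 0, 1)` is log-convex in this sense). [folklore] -/
theorem eq_zero_of_logConvexOn_of_eq_zero {g : ℕ → ℝ} {M : ℕ}
    (hconv : ∀ i, i + 2 ≤ M → g (i + 1) ^ 2 ≤ g i * g (i + 2)) {i₀ : ℕ} (hi₀ : i₀ ≤ M)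
    (hz : g i₀ = 0) {j : ℕ} (hj0 : 0 < j) (hjM : j < M) : g j = 0 := by
  -- a square bounded by zero vanishes
  have sq0 : ∀ {x y z : ℝ}, x ^ 2 ≤ y * z → y * z = 0 → x = 0 := fun h h0 =>
    pow_eq_zero_iff two_ne_zero |>.mp (le_antisymm (h.trans h0.le) (sq_nonneg _))
  -- upward propagation: `g k = 0` for `i₀ ≤ k`, `k + 1 ≤ M`
  have up : ∀ d : ℕ, i₀ + d + 1 ≤ M → g (i₀ + d) = 0 := by
    intro d
    induction d with
    | zero =>
      intro _; simpa using hz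
    | succ d ih =>
      intro hd
      have h := hconv (i₀ + d) (by omega)
      have h0 : g (i₀ + d) * g (i₀ + d + 2) = 0 := by rw [ih (by omega), zero_mul]
      have := sq0 h h0
      rwa [show i₀ + (d + 1) = i₀ + d + 1 by ring]
  -- downward propagation: `g k = 0` for `1 ≤ k ≤ i₀`
  have down : ∀ d : ℕ, d + 1 ≤ i₀ → g (i₀ - d) = 0 := by
    intro d
    induction d with
    | zero =>
      intro _; simpa using hz
    | succ d ih =>
      intro hd
      -- convexity centred at `i₀ - (d+1)`: `g(i₀-(d+1))² ≤ g(i₀-(d+1)-1) · g(i₀-d)`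
      have h' := hconv (i₀ - (d + 1) - 1) (by omega)
      have e4 : i₀ - (d + 1) - 1 + 1 = i₀ - (d + 1) := by omega
      have e5 : i₀ - (d + 1) - 1 + 2 = i₀ - d := by omega
      rw [e4, e5] at h'
      have h0 : g (i₀ - (d + 1) - 1) * g (i₀ - d) = 0 := by rw [ih (by omega), mul_zero]
      exact sq0 h' h0
  rcases le_or_gt i₀ j with hle | hlt
  · have := up (j - i₀) (by omega)
    rwa [Nat.add_sub_cancel' hle] at this
  · have := down (i₀ - j) (by omega)
    rwa [Nat.sub_sub_self hlt.le] at this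

/-- **The chord bound for a non-negative log-convex sequence on a finite range** (`g (i+1)² ≤ g i · g (i+2)` for
`i + 2 ≤ M`): `g j ^ M ≤ g 0 ^ (M − j) · g M ^ j` for all `j ≤ M` — `log g` lies below its chord.  Proof: if `g`
has a zero in the range, all interior values vanish (`eq_zero_of_logConvexOn_of_eq_zero`) and the inequality is
trivial; otherwise the ratios `g (i+1) / g i` are non-decreasing, so the geometric mean of the first `j` ratios is at
most that of the remaining `M − j`. [folklore] -/
theorem pow_le_pow_mul_pow_of_logConvexOn {g : ℕ → ℝ} {M : ℕ} (hnn : ∀ i, i ≤ M → 0 ≤ g i)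
    (hconv : ∀ i, i + 2 ≤ M → g (i + 1) ^ 2 ≤ g i * g (i + 2)) {j : ℕ} (hj : j ≤ M) :
    g j ^ M ≤ g 0 ^ (M - j) * g M ^ j := by
  -- the endpoints are trivial
  rcases Nat.eq_zero_or_pos j with rfl | hj0
  · simp
  rcases eq_or_lt_of_le hj with rfl | hjM
  · simp
  by_cases hall : ∀ i, i ≤ M → 0 < g i
  swap
  · -- a zero in the range: the interior vanishes, in particular `g j = 0`
    push Not at hall
    obtain ⟨i₀, hi₀, hgi₀⟩ := hall
    have hz : g i₀ = 0 := le_antisymm hgi₀ (hnn i₀ hi₀)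
    rw [eq_zero_of_logConvexOn_of_eq_zero hconv hi₀ hz hj0 hjM, zero_pow (by omega)]
    exact mul_nonneg (pow_nonneg (hnn 0 (Nat.zero_le _)) _) (pow_nonneg (hnn M le_rfl) _)
  -- all values positive: ratios
  set ρ : ℕ → ℝ := fun i => g (i + 1) / g i with hρ
  have hρ0 : ∀ i, i + 1 ≤ M → 0 < ρ i := fun i hi =>
    div_pos (hall (i + 1) hi) (hall i (by omega))
  have hρstep : ∀ i, i + 2 ≤ M → ρ i ≤ ρ (i + 1) := by
    intro i hi
    change g (i + 1) / g i ≤ g (i + 1 + 1) / g (i + 1)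
    rw [div_le_div_iff₀ (hall i (by omega)) (hall (i + 1) (by omega)), show i + 1 + 1 = i + 2 by ring]
    nlinarith [hconv i hi]
  have hρmono : ∀ i k, i ≤ k → k + 1 ≤ M → ρ i ≤ ρ k := by
    intro i k hik hk
    obtain ⟨d, rfl⟩ := Nat.exists_eq_add_of_le hik
    clear hik
    induction d with
    | zero => simp
    | succ d ih =>
      exact (ih (by omega)).trans (by rw [← add_assoc]; exact hρstep (i + d) (by omega))
  -- telescoping products
  have htel : ∀ k, k ≤ M → g k = g 0 * ∏ i ∈ range k, ρ i := by
    intro k hk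
    induction k with
    | zero => simp
    | succ k ih =>
      rw [prod_range_succ, ← mul_assoc, ← ih (by omega)]
      change g (k + 1) = g k * (g (k + 1) / g k)
      rw [mul_div_cancel₀ _ (hall k (by omega)).ne']
  have htel2 : g M = g j * ∏ i ∈ Ico j M, ρ i := by
    rw [htel M le_rfl, htel j hj, mul_assoc, prod_range_mul_prod_Ico _ hj]
  -- compare both partial products with the pivot ratio `c = ρ (j-1)`
  set c : ℝ := ρ (j - 1) with hc
  have hc0 : 0 ≤ c := (hρ0 (j - 1) (by omega)).le
  have hA0 : 0 ≤ ∏ i ∈ range j, ρ i := prod_nonneg fun i hi => (hρ0 i (by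
    have := mem_range.mp hi; omega)).le
  have hA : ∏ i ∈ range j, ρ i ≤ c ^ j := by
    calc ∏ i ∈ range j, ρ i ≤ ∏ _i ∈ range j, c :=
          prod_le_prod (fun i hi => (hρ0 i (by have := mem_range.mp hi; omega)).le)
            (fun i hi => hρmono i (j - 1) (by have := mem_range.mp hi; omega) (by omega))
      _ = c ^ j := by rw [prod_const, card_range]
  have hB : c ^ (M - j) ≤ ∏ i ∈ Ico j M, ρ i := by
    calc c ^ (M - j) = ∏ _i ∈ Ico j M, c := by rw [prod_const, Nat.card_Ico]
      _ ≤ ∏ i ∈ Ico j M, ρ i :=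
          prod_le_prod (fun _ _ => hc0)
            (fun i hi => hρmono (j - 1) i (by have := (mem_Ico.mp hi).1; omega)
              (by have := (mem_Ico.mp hi).2; omega))
  -- `A^(M-j) ≤ c^(j(M-j)) ≤ B^j`
  have hAB : (∏ i ∈ range j, ρ i) ^ (M - j) ≤ (∏ i ∈ Ico j M, ρ i) ^ j := by
    calc (∏ i ∈ range j, ρ i) ^ (M - j) ≤ (c ^ j) ^ (M - j) := pow_le_pow_left₀ hA0 hA _
      _ = (c ^ (M - j)) ^ j := by rw [← pow_mul, ← pow_mul, mul_comm]
      _ ≤ (∏ i ∈ Ico j M, ρ i) ^ j := pow_le_pow_left₀ (pow_nonneg hc0 _) hB _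
  -- assemble
  have hg0 : 0 ≤ g 0 := hnn 0 (Nat.zero_le _)
  have hgj : 0 ≤ g j := hnn j hj
  calc g j ^ M = g j ^ j * g j ^ (M - j) := by rw [← pow_add, Nat.add_sub_cancel' hj]
    _ = g j ^ j * (g 0 * ∏ i ∈ range j, ρ i) ^ (M - j) := by rw [← htel j hj]
    _ = g j ^ j * (g 0 ^ (M - j) * (∏ i ∈ range j, ρ i) ^ (M - j)) := by rw [mul_pow]
    _ ≤ g j ^ j * (g 0 ^ (M - j) * (∏ i ∈ Ico j M, ρ i) ^ j) := by
        gcongr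
    _ = g 0 ^ (M - j) * (g j * ∏ i ∈ Ico j M, ρ i) ^ j := by rw [mul_pow]; ring
    _ = g 0 ^ (M - j) * g M ^ j := by rw [← htel2]

/-- **The chord bound on a translated range** `[n₀, N]`: for `f ≥ 0` with `f (n+1)² ≤ f n · f (n+2)` whenever
`n₀ ≤ n`, `n + 2 ≤ N`, and every `n₀ ≤ n ≤ N`, `f n ^ (N − n₀) ≤ f n₀ ^ (N − n) · f N ^ (n − n₀)`. [folklore] -/
theorem pow_le_pow_mul_pow_of_logConvexOn' {f : ℕ → ℝ} {n₀ N : ℕ} (hnn : ∀ n, n₀ ≤ n → n ≤ N → 0 ≤ f n)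
    (hconv : ∀ n, n₀ ≤ n → n + 2 ≤ N → f (n + 1) ^ 2 ≤ f n * f (n + 2)) {n : ℕ} (h₁ : n₀ ≤ n)
    (h₂ : n ≤ N) : f n ^ (N - n₀) ≤ f n₀ ^ (N - n) * f N ^ (n - n₀) := by
  have h := pow_le_pow_mul_pow_of_logConvexOn (g := fun i => f (n₀ + i)) (M := N - n₀)
    (fun i hi => hnn (n₀ + i) (by omega) (by omega))
    (fun i hi => by
      have := hconv (n₀ + i) (by omega) (by omega)
      simpa only [add_assoc] using this)
    (j := n - n₀) (by omega)
  simp only [add_zero] at h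
  rwa [Nat.add_sub_cancel' h₁, Nat.add_sub_cancel' (h₁.trans h₂),
    show N - n₀ - (n - n₀) = N - n by omega] at h

/-- **No dilution when the range is long compared with the logarithm of the endpoint constant.**  For `g ≥ 0`
log-convex on `[0, M]` with `g 0 ≤ A` and the endpoint bound `g M ≤ W · r ^ M`, at any rate `r' > 0` (of interest:
`0 ≤ r ≤ r'`, `0 ≤ W`) one has for every `j ≤ M`
`g j ≤ max A 1 · max (W · (r / r') ^ M) 1 · r' ^ j`:
the endpoint constant enters only through `W (r/r')^M`, which is `≤ 1` as soon as `log W ≤ M · log (r'/r)`.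
(Lattice reading: on a torus of `M` time steps a per-observable clustering constant `W` at rate `r = e^{−εa}` costs
nothing at any rate `ε' < ε` once `log W ≤ (ε − ε') a M`.) [folklore] -/
theorem le_mul_pow_of_logConvexOn {g : ℕ → ℝ} {M : ℕ} (hnn : ∀ i, i ≤ M → 0 ≤ g i)
    (hconv : ∀ i, i + 2 ≤ M → g (i + 1) ^ 2 ≤ g i * g (i + 2)) {A W r r' : ℝ} (hA : g 0 ≤ A)
    (hr'0 : 0 < r') (hW : g M ≤ W * r ^ M) {j : ℕ} (hj : j ≤ M) :
    g j ≤ max A 1 * max (W * (r / r') ^ M) 1 * r' ^ j := by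
  set A₁ := max A 1 with hA₁
  set K₁ := max (W * (r / r') ^ M) 1 with hK₁
  have hA₁1 : 1 ≤ A₁ := le_max_right _ _
  have hK₁1 : 1 ≤ K₁ := le_max_right _ _
  have hgA : g 0 ≤ A₁ := hA.trans (le_max_left _ _)
  -- the endpoint bound in terms of `K₁` and `r'`: `g M ≤ K₁ r'^M`
  have hend : g M ≤ K₁ * r' ^ M := by
    calc g M ≤ W * r ^ M := hW
      _ = W * (r / r') ^ M * r' ^ M := by
          rw [div_pow, mul_assoc, div_mul_cancel₀ _ (pow_ne_zero _ hr'0.ne')]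
      _ ≤ K₁ * r' ^ M := mul_le_mul_of_nonneg_right (le_max_left _ _) (pow_nonneg hr'0.le _)
  rcases Nat.eq_zero_or_pos M with rfl | hM
  · -- `M = 0`: `j = 0`
    obtain rfl : j = 0 := by omega
    simp only [pow_zero, mul_one]
    calc g 0 ≤ A₁ := hgA
      _ = A₁ * 1 := (mul_one _).symm
      _ ≤ A₁ * K₁ := mul_le_mul_of_nonneg_left hK₁1 (by linarith)
  -- chord: `g j ^ M ≤ g 0 ^ (M-j) g M ^ j ≤ A₁^(M-j) (K₁ r'^M)^j ≤ (A₁ K₁ r'^j)^M`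
  have hch := pow_le_pow_mul_pow_of_logConvexOn hnn hconv hj
  have hgj : 0 ≤ g j := hnn j hj
  have hub : g j ^ M ≤ (A₁ * K₁ * r' ^ j) ^ M := by
    calc g j ^ M ≤ g 0 ^ (M - j) * g M ^ j := hch
      _ ≤ A₁ ^ (M - j) * (K₁ * r' ^ M) ^ j := by
          apply mul_le_mul
          · exact pow_le_pow_left₀ (hnn 0 (Nat.zero_le _)) hgA _
          · exact pow_le_pow_left₀ (hnn M le_rfl) hend _
          · exact pow_nonneg (hnn M le_rfl) _
          · exact pow_nonneg (by linarith) _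
      _ ≤ A₁ ^ M * (K₁ ^ M * (r' ^ M) ^ j) := by
          rw [mul_pow]
          apply mul_le_mul
          · exact pow_le_pow_right₀ hA₁1 (Nat.sub_le _ _)
          · apply mul_le_mul_of_nonneg_right
            · exact pow_le_pow_right₀ hK₁1 hj
            · positivity
          · positivity
          · positivity
      _ = (A₁ * K₁ * r' ^ j) ^ M := by
          rw [mul_pow, mul_pow, ← pow_mul, ← pow_mul, mul_comm M j]; ring
  exact le_of_pow_le_pow_left₀ (by omega) (by positivity) hub

end Chord

end Literature.Analysis.Convex
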